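import Summits.BirchSwinnertonDyer.Rank1Residual.Supersingular.X6KuriharaOfferShape
import Summits.BirchSwinnertonDyer.Rank1Residual.X11b.VisibilityPrimeList
import Literature.NumberTheory.EllipticCurves.Fisher2016.CongruentKummerConditions
import Literature.NumberTheory.EllipticCurves.Fisher2012.HesseFamilyFiveClosedForms
import Literature.NumberTheory.EllipticCurves.Rank1Residual.Typed.CasselsLowerBound
import Literature.NumberTheory.EllipticCurves.Rank1Residual.Typed.X6
import Literature.NumberTheory.EllipticCurves.Rank1Residual.Typed.X11Visibility
import Literature.NumberTheory.EllipticCurves.TorsionFrobeniusProofs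
import HarnessLib

/-!
# N4 TAM-DEFECT by VISIBILITY — the SHAPE: X6 ∧ `r_an = 0` ∧ odd `p` ∧ `ord_p #Ш_an ≤ 2` + a `p`-congruent partner with
# the four-kind refined count ⟹ `BSD(E,p)` (Wuthrich's upper bound, NO Tamagawa hypothesis, + Cassels–Tate); place-indexed
# reduction helpers.  Records (first: `22678e1 @ 5 ← 430882i1`) in `X6VisibilityTamDefectRecords.lean`

Cell `b2b-bsdres`, supersingular family, prover A = unit `b2b-bsdres-x10b` (gen 15), N4 class lead.  Topic file;
namespace `Summit.BirchSwinnertonDyer.Rank1Residual.Supersingular`.  THEOREMS ONLY (compositions by name); no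
named fact, no definition, nothing booked; X6 stays CONSTRUCTION-SHAPED (mark of RESIDUAL-MAP §I N4 unchanged).

HONEST FRAMING (run/shared/lean/b2b/bsd-rank1-residual/, verbatim in every file): the goal of the cell is to
DELETE the COMBINATION-SHAPED residual classes of the Birch–Swinnerton-Dyer formula for ALL analytic-rank `≤ 1`
elliptic curves over `ℚ` — "full BSD formula for every rank `≤ 1` curve in class `C`" assembled STRICTLY from
published theorems — so that the rank-`≤ 1` remainder becomes exactly the CONSTRUCTION-SHAPED classes, which are
TYPED (missing-input `Prop`s), NOT attempted.  This is not "finishing BSD".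

## Why this file exists (the N4 residue)

After gen 14 the per-pair instrument line on N4 (X6 ∧ `r_an = 0`, 123 cells) stood at 119/123; the residue =
the four TAM-DEFECT cells (`p ∣ ∏c_ℓ`, `#Ш_an = p²`), where Kim's Kurihara-number route needs a two-prime level
of depth `ord_p ∏c + 1` costing ≥ 2.4e12 series terms.  Wuthrich's Prop. 21 (the UPPER half,
`ord_p #Ш ≤ ord_p #Ш_an`) carries NO Tamagawa hypothesis, so on these cells ANY certificate of `p ∣ #Ш(E)` closes
`BSD(E,p)` (Cassels–Tate squareness: the tree's `missingLowerBoundAt_of_casselsTate_of_pow_dvd`, x11b).  For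
`22678e1 @ 5` such a certificate is a VISIBLE element: the rank-`2` curve `F = 430882i1` (Cremona; conductor
`430882 = 19 · 22678`) is `5`-congruent to `E = 22678e1` (the mod-`5` representation of `E` is unramified at
`2` since `5 ∣ c₂(E) = ord₂ Δ_E = 75`, and `F` is a level-RAISED companion at `19`, where
`a₁₉(E) = 5 ≡ −(19+1) (mod 5)`).  Gen 11 (x10b) had set this partner aside because the cell's count of the day
charged one unit of rank at `19` (`F` non-split multiplicative, `19 ≡ −1 (mod 5)`, `F(ℚ₁₉)[5] ≅ ℤ/5`) and one at
`5`: `5 · 5 = 25 ≮ 5^{rank F} = 25`.  Since then the tree acquired the FOURTH free kind of place — Fisher 2016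
Thm. 4.4 (named fact `Fisher2016.thm44_selmerLocalKer_iff_of_nonsplit_good`, literature seat): at a place where
one curve is non-split multiplicative and the other has good reduction the local Kummer conditions AGREE — which is
exactly `19` here (`E` good, `F` non-split).  The count becomes `5 · #F(ℚ₅)[5] = 5 < 25`: `Ш(E)[5] ≠ 0`.

## What this file proves (the SHAPE and the place-indexed helpers); the records file decides, per pair:

KERNEL (`X6VisibilityTamDefectRecords.lean`): both integer models elliptic and globally minimal (Kraus, x11c/additive-p3 bounded form);
`ClassX6 E 5` (`5 ∤ Δ_E`, `#Ẽ(𝔽₅) = 6`, `gcd(Δ_E, c₄(E)) = 1`; `classX6_of_intModel`); the discriminant supports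
`|Δ_E| = 2^75·17·23·29^4`, `Δ_F = 2^5·17·19^5·23·29` (so both curves have good reduction off
`S = {2, 5, 17, 19, 23, 29}` and at `5`, `E` also at `19`); multiplicative reduction of `E` at `2, 29` and of `F`
at `2, 19, 29` (`ℓ ∣ Δ`, `ℓ ∤ c₄`); `F` NON-split at `19` (the node-tangent quadratic of `F` mod `19` has no
root); `E(ℚ)` finite of order prime to `5` (rank `0` + `ClassX6.irr`); the `5`-CONGRUENCE `θ : F[5] ≅ E[5]`
ITSELF when the Hesse-certificate form is used (Fisher 2012 Thm. 13.2 + two `norm_num` identities; records file) —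
in the plain form `θ` is a displayed binder.  HERE: §1 `X6RankZero.bsdp_of_casselsTate_of_congr_of_places₄` (the
composition Wuthrich + Cassels–Tate + `exists_sha_ne_zero_of_congr_of_places₄_rat`, class X6, odd `p`); §2 helpers
turning `ℓ ∣ Δ(E₀)`, `ℓ ∤ c₄(E₀)`, root-freeness of the node-tangent quadratic, `ℓ ∤ Δ(E₀)` into the PLACE-indexed
`HasMultiplicativeReductionAt` / `¬ HasSplitMultiplicativeReductionAt` / `HasGoodReductionAt` the count consumes.
BINDERS (displayed hypotheses, evidence in HOME/b2b-bsdres-x10b/gen15/, two engines — PARI/GP kit j153827 and the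
pure-python `local.py`): `rank F(ℚ) ≥ 2` (Cremona; generators `(−66, 44)`, `(138, 124)`, independent in
`F(ℚ)/5F(ℚ)` by reduction functionals); `#F(ℚ_v)[5] = 1` at `v = 5, 17, 23` (supersingular at `5`; non-split at
`17 ≢ −1`, `23 ≢ −1 (mod 5)`); at `v = 2, 29` (both curves multiplicative of the same type — split at `2`,
non-split at `29`): `γ(E)/γ(F) ∈ ℚ_v^{×2}` and `μ₅(ℚ_v) = 1` (`v ≢ 1 (mod 5)`); and the Cremona data of the
target (`r_an = 0`, `#Ш_an = 25`).  Published inputs by name: Cassels–Tate (`hCT`), Wuthrich 2014 Prop. 21 (`hW`),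
GZK (`hGZK`), modularity (`hmod`), Tate uniformisation (`hU`, `hU2`), Fisher 2016 Thm. 4.4 (`hF44`) [, Fisher 2012
Thm. 13.2 (`hF13`)].  PER PAIR (an OFFER for referee A); NOT a class theorem; nothing booked.

References: Cremona–Mazur 2000 §3 [CremonaMazur2000]; Agashe–Stein 2002 Thm. 3.1 [AgasheStein2002]; Fisher 2016
Thm. 4.4 [Fisher2016Visualizing7]; Fisher 2012 Thm. 13.2 [Fisher2012Hessian]; Wuthrich 2014 Prop. 21
[Wuthrich2014]; Silverman AEC VII.5.1, X.4.14 [SilvermanAEC2009]; ATAEC V [SilvermanATAEC1994]; Cremona's tables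
[Cremona2006]; HOME/b2b-bsdres-x10b/X6-KURIHARA.md §18.
-/

set_option autoImplicit false

noncomputable section

open scoped Classical

open WeierstrassCurve Literature.NumberTheory.EllipticCurves
  Literature.NumberTheory.EllipticCurves.Rank1Residual
  Literature.NumberTheory.EllipticCurves.Rank1Residual.Typed
  Literature.NumberTheory.EllipticCurves.Rank1Residual.X11RankOneCertificates
  Literature.NumberTheory.EllipticCurves.Wuthrich2014
  Literature.NumberTheory.EllipticCurves.Fisher2016
  Literature.NumberTheory.EllipticCurves.Fisher2012
  Summit.BirchSwinnertonDyer.BirchSwinnertonDyer.Rank1Residual.IntModel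
  Summit.BirchSwinnertonDyer.Rank1Residual.X11b
open NumberField IsDedekindDomain Rat.HeightOneSpectrum

namespace Summit.BirchSwinnertonDyer.Rank1Residual.Supersingular

/-! ### §1. Class-free SHAPE: X6 ∧ `r_an = 0` ∧ odd `p` ∧ `ord_p #Ш_an ≤ 2` + a `p`-congruent partner with the
four-kind refined count ⟹ `BSD(E,p)` (Wuthrich + Cassels–Tate; NO Tamagawa hypothesis) -/

/-- **X6 ∩ {r_an = 0}, odd `p`, `ord_p #Ш_an ≤ 2`: `BSD(E,p)` from PUBLISHED theorems plus a `p`-CONGRUENT curve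
`W'` with the FOUR-KIND refined visibility count** (pay at `T ⊆ S`; kinds (i) `v ∤ p`, `W'(ℚ_v)[p] = 0`,
(ii) both split multiplicative with `#W(ℚ_v)[p] ≤ p`, (iii) both multiplicative of the same `γ`-class with
`μ_p(ℚ_v) = 1`, (iv) one curve non-split multiplicative and the other good — Fisher 2016 Thm. 4.4).  Chain:
`Ш(E)[p] ≠ 0` (`exists_sha_ne_zero_of_congr_of_places₄_rat`; `E(ℚ)` finite of order prime to `p` by GZK +
`ClassX6.irr`) ⟹ `p ∣ #Ш` ⟹ `ord_p #Ш_an ≤ ord_p #Ш` (Cassels–Tate squareness, `ord_p #Ш_an ≤ 2`) ⟹ `BSD(E,p)` by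
Wuthrich's Prop. 21 (`X6.bsdp_of_missingLowerBoundAt_of_analyticRank_eq_zero`; image proviso `ClassX6.surj`).
NO hypothesis on the Tamagawa numbers of `W`.  Per pair; NOT a class theorem.
[cite: Wuthrich2014, Prop. 21 (p. 400)] [cite: Fisher2016Visualizing7, Thm. 4.4 (p. 106)]
[cite: CremonaMazur2000, §3 and Table 1] [cite: SilvermanAEC2009, Thm. X.4.14] -/
theorem X6RankZero.bsdp_of_casselsTate_of_congr_of_places₄
    (hCT : exists_casselsTate_pairing (K := ℚ)) (hW : sha_dvd_analyticSha)
    (hGZK : rank_eq_analyticRank_of_analyticRank_le_one) (hmod : hasEntireLFunction_rat)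
    (hU : Silverman1994_thmV53_tateUniformisation.{0})
    (hU2 : Silverman1994_thmV53_corV54_tateUniformisation.{0})
    (hF44 : thm44_selmerLocalKer_iff_of_nonsplit_good)
    (W : WeierstrassCurve ℚ) [W.IsElliptic] [W.IsGloballyMinimal] (p : ℕ) [Fact p.Prime] (hp : p ≠ 2)
    (hX : ClassX6 W p) (hr : W.analyticRank = 0) {q : ℚ} (hq : shaAn W = (q : ℂ)) (hv : padicValRat p q ≤ 2)
    (W' : WeierstrassCurve ℚ) [W'.IsElliptic]
    (θ : geomTorsion W' (p : ℤ) ≃+ geomTorsion W (p : ℤ))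
    (hθ : ∀ (σ : Field.absoluteGaloisGroup ℚ) (P : geomTorsion W' (p : ℤ)), θ (σ • P) = σ • θ P)
    (S T : Finset (HeightOneSpectrum (𝓞 ℚ))) (hTS : T ⊆ S)
    (hS : ∀ w : HeightOneSpectrum (𝓞 ℚ), w ∉ S →
      W.HasGoodReductionAt w ∧ W'.HasGoodReductionAt w ∧ (p : 𝓞 ℚ) ∉ w.asIdeal)
    (hT : (∏ w ∈ T, Nat.card (nsmulAddMonoidHom p :
        (W'.baseChange (w.adicCompletion ℚ)).toAffine.Point →+ _).ker *
        Nat.card (w.adicCompletionIntegers ℚ ⧸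
          Ideal.span {(p : w.adicCompletionIntegers ℚ)})) < p ^ W'.mordellWeilRank)
    (hplaces : ∀ w ∈ S, w ∉ T →
      ((p : 𝓞 ℚ) ∉ w.asIdeal ∧ Nat.card (nsmulAddMonoidHom p :
          (W'.baseChange (w.adicCompletion ℚ)).toAffine.Point →+ _).ker = 1) ∨
      (W.HasSplitMultiplicativeReductionAt w ∧ W'.HasSplitMultiplicativeReductionAt w ∧
        Nat.card (nsmulAddMonoidHom p :
          (W.baseChange (w.adicCompletion ℚ)).toAffine.Point →+ _).ker ≤ p) ∨
      (W.HasMultiplicativeReductionAt w ∧ W'.HasMultiplicativeReductionAt w ∧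
        (∃ r : w.adicCompletion ℚ, algebraMap ℚ (w.adicCompletion ℚ) (-(W.c₄ / W.c₆)) =
          r ^ 2 * algebraMap ℚ (w.adicCompletion ℚ) (-(W'.c₄ / W'.c₆))) ∧
        (∀ ζ : w.adicCompletion ℚ, ζ ^ p = 1 → ζ = 1)) ∨
      ((W.HasMultiplicativeReductionAt w ∧ ¬ W.HasSplitMultiplicativeReductionAt w ∧
          W'.HasGoodReductionAt w) ∨
        (W.HasGoodReductionAt w ∧ W'.HasMultiplicativeReductionAt w ∧
          ¬ W'.HasSplitMultiplicativeReductionAt w))) :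
    BSDp W p := by
  haveI hfin : Finite W.toAffine.Point := finite_point_of_analyticRank_eq_zero W hGZK hr
  have hirr : Irr W p := ClassX6.irr W p hp hX
  have hcop : (Nat.card W.toAffine.Point).Coprime p := coprime_natCard_point_of_irr W p hirr
  have hex : ∃ c : W.sha, c ≠ 0 ∧ p • c = 0 :=
    W.exists_sha_ne_zero_of_congr_of_places₄_rat hU hU2 hF44 hp W' θ hθ S T hTS hS hfin hcop hT hplaces
  have hfinSha : W.ShaFinite := (hGZK W (by rw [hr]; norm_num)).2
  have hlow : MissingLowerBoundAt W p :=
    missingLowerBoundAt_of_casselsTate_of_pow_dvd W p hCT hfinSha hq (k := 1) (by simpa using hv)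
      (by simpa using dvd_shaOrder_of_exists_torsion W p hex)
  exact X6.bsdp_of_missingLowerBoundAt_of_analyticRank_eq_zero W p hW hGZK hmod hp hX hr hlow


/-! ### §2. Place-indexed reduction data read off an integer model (helpers) -/

/-- Multiplicative reduction at the place `w` over `ℓ` from the integer model: `ℓ ∣ Δ(E₀)`, `ℓ ∤ c₄(E₀)`
(Silverman AEC VII.5.1(b); the tree's `hasMultiplicativeReductionAt_of_dvd_of_not_dvd`). [cite: SilvermanAEC2009, VII.5 Prop. 5.1(b)] -/
theorem hasMultiplicativeReductionAt_of_intModel_of_primesEquiv {W : WeierstrassCurve ℚ} [W.IsElliptic]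
    [W.IsGloballyMinimal] {E₀ : WeierstrassCurve ℤ} (hI : integralModelInt W = E₀)
    (w : HeightOneSpectrum (𝓞 ℚ)) {ℓ : ℕ} (hw : (primesEquiv w : ℕ) = ℓ)
    (hΔ : (ℓ : ℤ) ∣ E₀.Δ) (hc₄ : ¬ (ℓ : ℤ) ∣ E₀.c₄) : W.HasMultiplicativeReductionAt w := by
  refine W.hasMultiplicativeReductionAt_of_dvd_of_not_dvd w ?_ ?_
  · rw [hw, minimalDiscriminantInt_eq hI]; exact hΔ
  · rw [hw, hI]; exact hc₄

/-- NON-split multiplicative reduction at the place `w` over `ℓ` from the integer model: `ℓ ∣ Δ(E₀)`,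
`ℓ ∤ c₄(E₀)` and the node-tangent quadratic of `E₀` mod `ℓ` has no root (the tree's
`not_hasSplitMultiplicativeReductionAtPrime_of_intModel_of_noroot`, moved to the place).
[cite: SilvermanAEC2009, VII.5 Prop. 5.1(b)] -/
theorem not_hasSplitMultiplicativeReductionAt_of_intModel_of_noroot {W : WeierstrassCurve ℚ} [W.IsElliptic]
    [W.IsGloballyMinimal] {E₀ : WeierstrassCurve ℤ} (hI : integralModelInt W = E₀)
    (w : HeightOneSpectrum (𝓞 ℚ)) {ℓ : ℕ} [hℓ : Fact ℓ.Prime] (hw : (primesEquiv w : ℕ) = ℓ)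
    (hΔ : (ℓ : ℤ) ∣ E₀.Δ) (hc₄ : ¬ (ℓ : ℤ) ∣ E₀.c₄)
    (hnoroot : ∀ t : ZMod ℓ, (E₀.c₄ : ZMod ℓ) * t ^ 2 + (E₀.a₁ * E₀.c₄ : ZMod ℓ) * t
      - (54 * E₀.b₆ - 3 * E₀.b₂ * E₀.b₄ + E₀.a₂ * E₀.c₄ : ZMod ℓ) ≠ 0) :
    ¬ W.HasSplitMultiplicativeReductionAt w := by
  have h1 := not_hasSplitMultiplicativeReductionAtPrime_of_intModel_of_noroot hI ℓ hΔ hc₄ hnoroot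
  have key : ∀ q : Nat.Primes, primesEquiv w = q →
      ((haveI := Fact.mk q.2; W.HasSplitMultiplicativeReductionAtPrime (q : ℕ)) ↔
        W.HasSplitMultiplicativeReductionAt w) := by
    rintro q rfl
    exact hasSplitMultiplicativeReductionAtPrime_iff_hasSplitMultiplicativeReductionAt W w
  have hq : primesEquiv w = ⟨ℓ, hℓ.out⟩ := Subtype.ext hw
  rw [← key _ hq]
  exact h1

/-- Good reduction at the place `w` over `ℓ ∤ Δ(E₀)` for the literal equation (Silverman AEC VII.5.1(a); the
tree's `hasGoodReductionAt_map_of_not_dvd`). [cite: SilvermanAEC2009, VII.5 Prop. 5.1(a)] -/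
theorem hasGoodReductionAt_mk_of_primesEquiv (a1 a2 a3 a4 a6 : ℤ) (w : HeightOneSpectrum (𝓞 ℚ)) {ℓ : ℕ}
    (hw : (primesEquiv w : ℕ) = ℓ) (hΔ : ¬ (ℓ : ℤ) ∣ (⟨a1, a2, a3, a4, a6⟩ : WeierstrassCurve ℤ).Δ) :
    (⟨a1, a2, a3, a4, a6⟩ : WeierstrassCurve ℚ).HasGoodReductionAt w := by
  rw [← map_mk_int]
  exact hasGoodReductionAt_map_of_not_dvd _ w (by rw [hw]; exact hΔ)

/-- `p ∉ w` at a place `w` over a prime `ℓ ≠ p`. [folklore] -/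
theorem natCast_not_mem_of_primesEquiv_ne (w : HeightOneSpectrum (𝓞 ℚ)) {p : ℕ} (hp : p.Prime)
    (hw : (primesEquiv w : ℕ) ≠ p) : (p : 𝓞 ℚ) ∉ w.asIdeal :=
  fun h ↦ hw (primesEquiv_eq_of_natCast_mem hp h)

end Summit.BirchSwinnertonDyer.Rank1Residual.Supersingular

end
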